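import Mathlib
import HarnessLib

/-!
# Free canonical gas at `β·t = 8` — the good arc has a uniform resolvent gap: `‖(1 + ζK)v‖ ≥ sin φ₀ · ‖v‖`

Helper file for route `TcThermcert1` (crux K1′ `ThermalStiffnessCeilingU8b8_le_7o44`, item `stmt-Ventures-24560`), crux idea
`free-canonical-b8-rung` (stub S4 `stub_arcPropagator_decay`: decay of the complex-fugacity Fermi kernel `G_ζ = ζK(1+ζK)⁻¹`,
`K = e^{−βh} ⪰ 0`, on the good arc `|φ| ≤ φ₀ < π` of the fugacity circle `ζ = re^{iφ}`).

The quantitative input of every proof of S4 (Combes–Thomas, contour shift, or polynomial approximation) is a bound on the resolvent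
`(1 + ζK)⁻¹` that is UNIFORM in the volume and in the radius `r`. For a positive semidefinite `K` it is elementary: for
`φ₀ ∈ [π/2, π)` (`cos φ₀ ≤ 0`) and every `φ` with `cos φ ≥ cos φ₀` (i.e. `|φ| ≤ φ₀`), every `r ≥ 0` and every vector `v`,

  `sin²φ₀ · ⟨v, v⟩ ≤ ⟨(1 + ζK)v, (1 + ζK)v⟩`,   `ζ = r e^{iφ}`

(§2, stated for any `φ₀` with `cos φ₀ ≤ cos φ`; scalar picture: `min_{κ ≥ 0} |1 + κe^{iφ}| = |sin φ|` for `cos φ ≤ 0`, `= 1` for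
`cos φ ≥ 0`). The proof completes a square using
only `⟨v + tKv, v + tKv⟩ ≥ 0` for one real `t` (no spectral theorem, no Cauchy–Schwarz API): §1 is the real-arithmetic core. §3: hence
`1 + ζK` is invertible on the good arc whenever `sin φ₀ ≠ 0`, with `‖(1 + ζK)⁻¹‖₂ ≤ 1/sin φ₀` in the Euclidean operator norm (stated
as the vector inequality; the operator-norm packaging is left to the S4 file).

HONEST LABEL: finite-dimensional linear algebra; a step of a RUNG (`U = 0`, BC5-type witness for the C8 bet), reach at `U = 8` ZERO; decides
nothing about K1/K1′/`T_c`; superconductivity in the Hubbard model is NOT proved or advanced by this file beyond the rung.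
-/

noncomputable section

namespace Summit.Ventures.CertifiedManyBodySolver.Theorems.TcThermcert1.FreeCanonicalB8

open Matrix
open scoped ComplexOrder ComplexConjugate

/-! ## §1 The real-arithmetic core -/

/-- If `a, p, q ≥ 0` satisfy `a + 2tp + t²q ≥ 0` for all real `t` (a Gram condition), `r ≥ 0` and `c₀ ≤ c`, then
`(1 − c₀²) a ≤ a + 2rc·p + r²q`. -/
theorem gap_core {a p q r c c₀ : ℝ} (ha : 0 ≤ a) (hp : 0 ≤ p) (hq : 0 ≤ q) (hr : 0 ≤ r) (hc : c₀ ≤ c)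
    (hg : ∀ t : ℝ, 0 ≤ a + 2 * t * p + t ^ 2 * q) : (1 - c₀ ^ 2) * a ≤ a + 2 * r * c * p + r ^ 2 * q := by
  rcases le_or_gt 0 c with hc0 | hc0
  · -- `c ≥ 0`: every term on the right is non-negative
    nlinarith [mul_nonneg (mul_nonneg hr hc0) hp, mul_nonneg (sq_nonneg r) hq, mul_nonneg (sq_nonneg c₀) ha]
  · -- `c₀ ≤ c < 0`: complete the square at `t = rc/c₀²`
    have hc₀0 : c₀ < 0 := lt_of_le_of_lt hc hc0
    have hc₀2 : 0 < c₀ ^ 2 := by rw [sq]; exact mul_pos_of_neg_of_neg hc₀0 hc₀0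
    have hcc : c ^ 2 ≤ c₀ ^ 2 := by
      rw [← neg_sq c₀]
      exact sq_le_sq' (by linarith) (by linarith)
    have h1 : 0 ≤ c₀ ^ 2 * (a + 2 * (r * c / c₀ ^ 2) * p + (r * c / c₀ ^ 2) ^ 2 * q) := mul_nonneg hc₀2.le (hg _)
    have h2 : c₀ ^ 2 * (a + 2 * (r * c / c₀ ^ 2) * p + (r * c / c₀ ^ 2) ^ 2 * q) =
        c₀ ^ 2 * a + 2 * r * c * p + (r ^ 2 * q) * (c ^ 2 / c₀ ^ 2) := by
      have hc₀ne : c₀ ≠ 0 := hc₀0.ne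
      field_simp
    have h3 : (r ^ 2 * q) * (c ^ 2 / c₀ ^ 2) ≤ r ^ 2 * q * 1 :=
      mul_le_mul_of_nonneg_left ((div_le_one hc₀2).2 hcc) (mul_nonneg (sq_nonneg r) hq)
    rw [h2] at h1
    nlinarith

/-! ## §2 The gap inequality -/

variable {Λ : Type*} [Fintype Λ] [DecidableEq Λ]

/-- A non-negative complex number is the cast of its real part. -/
theorem eq_ofReal_re_of_nonneg {z : ℂ} (hz : 0 ≤ z) : z = ((z.re : ℝ) : ℂ) := by
  obtain ⟨_, him⟩ := Complex.nonneg_iff.1 hz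
  exact Complex.ext (by simp) (by simp [← him])

/-- **Uniform resolvent gap on the good arc.** For `K ⪰ 0`, `r ≥ 0` and `cos φ₀ ≤ cos φ` (i.e. `|φ| ≤ φ₀` modulo `2π`), with
`ζ = r e^{iφ}`: `sin²φ₀ · ⟨v, v⟩ ≤ ⟨(1 + ζK)v, (1 + ζK)v⟩` for every vector `v` (in `ℂ` with its star order; both sides are real).
(For `φ₀ ≤ π/2` the sharper constant is `1`; the stated one is what the good arc `|φ| ≤ φ₀`, `φ₀ ∈ [π/2, π)`, needs.) -/
theorem goodArc_resolvent_gap {K : Matrix Λ Λ ℂ} (hK : K.PosSemidef) {r φ φ₀ : ℝ} (hr : 0 ≤ r)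
    (hφ : Real.cos φ₀ ≤ Real.cos φ) (v : Λ → ℂ) :
    ((Real.sin φ₀ ^ 2 : ℝ) : ℂ) * (star v ⬝ᵥ v) ≤
      star ((1 + ((r : ℂ) * Complex.exp (Complex.I * φ)) • K) *ᵥ v) ⬝ᵥ ((1 + ((r : ℂ) * Complex.exp (Complex.I * φ)) • K) *ᵥ v) := by
  set ζ : ℂ := (r : ℂ) * Complex.exp (Complex.I * φ) with hζ
  set u : Λ → ℂ := K *ᵥ v with hu
  -- the three non-negative reals `a = ⟨v,v⟩`, `p = ⟨v,Kv⟩`, `q = ⟨Kv,Kv⟩`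
  have ha0 : 0 ≤ star v ⬝ᵥ v := dotProduct_star_self_nonneg v
  have hp0 : 0 ≤ star v ⬝ᵥ u := (Matrix.posSemidef_iff_dotProduct_mulVec.1 hK).2 v
  have hq0 : 0 ≤ star u ⬝ᵥ u := dotProduct_star_self_nonneg u
  set a : ℝ := (star v ⬝ᵥ v).re with hadef
  set p : ℝ := (star v ⬝ᵥ u).re with hpdef
  set q : ℝ := (star u ⬝ᵥ u).re with hqdef
  have haC : star v ⬝ᵥ v = (a : ℂ) := eq_ofReal_re_of_nonneg ha0
  have hpC : star v ⬝ᵥ u = (p : ℂ) := eq_ofReal_re_of_nonneg hp0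
  have hqC : star u ⬝ᵥ u = (q : ℂ) := eq_ofReal_re_of_nonneg hq0
  have hpC' : star u ⬝ᵥ v = (p : ℂ) := by rw [star_dotProduct, hpC, Complex.star_def, Complex.conj_ofReal]
  have ha : 0 ≤ a := (Complex.nonneg_iff.1 ha0).1
  have hp : 0 ≤ p := (Complex.nonneg_iff.1 hp0).1
  have hq : 0 ≤ q := (Complex.nonneg_iff.1 hq0).1
  -- the Gram condition from `⟨v + tKv, v + tKv⟩ ≥ 0`
  have hg : ∀ t : ℝ, 0 ≤ a + 2 * t * p + t ^ 2 * q := by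
    intro t
    have h0 : 0 ≤ star (v + (t : ℂ) • u) ⬝ᵥ (v + (t : ℂ) • u) := dotProduct_star_self_nonneg _
    rw [star_add, star_smul, add_dotProduct, dotProduct_add, dotProduct_add, smul_dotProduct, smul_dotProduct, dotProduct_smul,
      dotProduct_smul, haC, hpC, hpC', hqC, Complex.star_def, Complex.conj_ofReal] at h0
    try simp only [smul_eq_mul] at h0
    have h1 : (a : ℂ) + (t : ℂ) * (p : ℂ) + ((t : ℂ) * (p : ℂ) + (t : ℂ) * ((t : ℂ) * (q : ℂ))) = ((a + 2 * t * p + t ^ 2 * q : ℝ) : ℂ) := by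
      push_cast; ring
    rw [h1] at h0
    exact_mod_cast (Complex.nonneg_iff.1 h0).1
  -- `ζ = re^{iφ}`: real part and modulus
  have hζre : ζ.re = r * Real.cos φ := by simp [hζ, Complex.exp_re, Complex.exp_im]
  have hn1 : Complex.normSq (Complex.exp (Complex.I * φ)) = 1 := by
    rw [Complex.normSq_eq_norm_sq, Complex.norm_exp]
    simp
  have hzz : star ζ * ζ = ((r ^ 2 : ℝ) : ℂ) := by
    rw [Complex.star_def, ← Complex.normSq_eq_conj_mul_self, hζ, Complex.normSq_mul, hn1, Complex.normSq_ofReal]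
    push_cast
    ring
  have hre : ζ + star ζ = ((2 * (r * Real.cos φ) : ℝ) : ℂ) := by
    rw [Complex.star_def, Complex.add_conj, hζre]
  -- expand the right-hand side: `⟨(1+ζK)v,(1+ζK)v⟩ = a + (ζ + conj ζ) p + |ζ|² q`
  have hexp : star ((1 + ζ • K) *ᵥ v) ⬝ᵥ ((1 + ζ • K) *ᵥ v) = ((a + 2 * r * Real.cos φ * p + r ^ 2 * q : ℝ) : ℂ) := by
    rw [Matrix.add_mulVec, Matrix.one_mulVec, Matrix.smul_mulVec, ← hu, star_add, star_smul, add_dotProduct, dotProduct_add,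
      dotProduct_add, smul_dotProduct, smul_dotProduct, dotProduct_smul, dotProduct_smul, haC, hpC, hpC', hqC]
    try simp only [smul_eq_mul]
    calc (a : ℂ) + ζ * (p : ℂ) + (star ζ * (p : ℂ) + star ζ * (ζ * (q : ℂ)))
        = (a : ℂ) + (ζ + star ζ) * (p : ℂ) + (star ζ * ζ) * (q : ℂ) := by ring
      _ = ((a + 2 * r * Real.cos φ * p + r ^ 2 * q : ℝ) : ℂ) := by
          rw [hre, hzz]
          push_cast
          ring
  rw [hexp, haC, ← Complex.ofReal_mul, Complex.real_le_real, Real.sin_sq]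
  exact gap_core ha hp hq hr hφ hg

/-! ## §3 Invertibility on the good arc -/

/-- **`1 + ζK` is invertible on the good arc** (`K ⪰ 0`, `ζ = re^{iφ}`, `r ≥ 0`, `sin φ₀ ≠ 0`, `cos φ₀ ≤ cos φ`). -/
theorem isUnit_one_add_smul_goodArc {K : Matrix Λ Λ ℂ} (hK : K.PosSemidef) {r φ φ₀ : ℝ} (hr : 0 ≤ r)
    (hs : Real.sin φ₀ ≠ 0) (hφ : Real.cos φ₀ ≤ Real.cos φ) :
    IsUnit (1 + ((r : ℂ) * Complex.exp (Complex.I * φ)) • K) := by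
  rw [← Matrix.mulVec_injective_iff_isUnit]
  intro v w hvw
  have hg := goodArc_resolvent_gap hK hr hφ (v - w)
  rw [Matrix.mulVec_sub, hvw, sub_self, star_zero, zero_dotProduct] at hg
  have ha0 : 0 ≤ star (v - w) ⬝ᵥ (v - w) := dotProduct_star_self_nonneg (v - w)
  rw [eq_ofReal_re_of_nonneg ha0, ← Complex.ofReal_mul, ← Complex.ofReal_zero, Complex.real_le_real] at hg
  have ha : 0 ≤ (star (v - w) ⬝ᵥ (v - w)).re := (Complex.nonneg_iff.1 ha0).1
  have hs2 : 0 < Real.sin φ₀ ^ 2 := by positivity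
  have hzero : (star (v - w) ⬝ᵥ (v - w)).re = 0 := by nlinarith
  have h0 : star (v - w) ⬝ᵥ (v - w) = 0 := by rw [eq_ofReal_re_of_nonneg ha0, hzero, Complex.ofReal_zero]
  exact sub_eq_zero.1 (dotProduct_star_self_eq_zero.1 h0)

end Summit.Ventures.CertifiedManyBodySolver.Theorems.TcThermcert1.FreeCanonicalB8

end
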